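import Mathlib
import Summits.ValiantsHypothesis.ValiantsHypothesis.Theorems.LiouvilleSarnakAlignedCutRank

/-!
# Route LiouvilleSarnak — crux `LiouvilleCutRank` (stmt-ValiantsHypothesis-14775):
# ARBITRARY (unbalanced) windows embed, and distinct window columns bound the rank

The window-transfer lemmas in the tree either need a BALANCED window (a level-`n₁` cut `π₁`,
`OneScale.rank_inducedCut_le`, `OneBlock.rank_inducedCut_shift_le`) or a finite `λ`-table
(`LiouvilleSarnakCutRankWindow.card_le_rank_of_window`).  The open core of the crux after the leafhand-2 census
(evidence on the item) contains words whose useful windows are UNBALANCED — CLASS B, "long isolated runs", e.g.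
`(R^L C)^m (R^a C^a)^{m'} (C^L R)^m`: a window `(R^L C)^k` has `kL` row letters and `k` column letters.  This file
supplies the table-free, balance-free tool:

* `rank_windowMatrix_le` — for ANY window `s, …, s+K-1` of a cut `π` (word `w` on the window) and ANY families of
  row streams `xr : α → ℕ → Bool` and column streams `yc : β → ℕ → Bool`, the `α × β` matrix
  `(λ(K_w(xr a, yc b) + 1))_{a,b}`, `K_w(x,y) = Σ_{k<K} 2^k [w k ? x k : y k]`, has rank `≤ rank M_π` (bits below the
  window `1`, above `0`: `N + 1 = 2^s (K_w + 1)` and `λ(2^s x) = (-1)^s λ(x)`; a signed submatrix).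
* `windowMatrix_entry_eq_or` — its entries are `±1`.
* ★ `le_rank_of_distinct_windowColumns` — if that window matrix has at least `2^m` pairwise distinct COLUMNS then
  `m ≤ rank M_π` (a `±1` matrix with `R` distinct columns has `R ≤ 2^{rank}`, `card_image_row_le_two_pow_rank` on the
  transpose).  For the window `(R^L C)^k` with all row streams this reads: if the `2^k` aligned `2^L`-blocks-with-digits
  `a ↦ λ(1 + Σ_j (a_j + 2^L ε_j) 2^{j(L+1)})`, `ε ∈ {0,1}^k`, are pairwise distinct functions of `a ∈ [0,2^L)^k`, then
  `rank M_π ≥ k` — the arithmetic residue of Class B is an injectivity ("no coincident aligned blocks on a digit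
  class") statement about `λ`, recorded in the census.

Honest framing: bookkeeping toward an OPEN crux; no new case of `LiouvilleCutRank` is proved here; `LiouvilleCutRank`,
`DigitalBilinearLiouville`, `AlgebraicSarnak` stay OPEN; nothing bears on `VP ≠ VNP`.  No definitions.
-/

set_option linter.dupNamespace false

noncomputable section

namespace Summit.ValiantsHypothesis.ValiantsHypothesis.Theorems.LiouvilleSarnakLiouvilleCutRank.WindowColumns

open ArithmeticFunction Finset

open Summit.ValiantsHypothesis.ValiantsHypothesis.Theorems.LiouvilleSarnakAligned
  (card_image_row_le_two_pow_rank liouville_two_pow_mul)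

/-! ### §1 Arbitrary windows embed as signed submatrices -/

/-- **Unbalanced window embedding.**  Let `π` be a cut of `2n` positions, `s, …, s+K-1` a window whose row/column
word is `w` (`w k = true` iff position `s+k` is a row position), and let `xr a`, `yc b` be arbitrary bit streams
(`a : α`, `b : β`).  Setting the bits below the window to `1`, the window bits to `xr a` on row positions and `yc b`
on column positions, and the bits above to `0` realises `(-1)^s λ(K_w(xr a, yc b) + 1)` as the entry of `M_π` at a
row depending only on `a` and a column depending only on `b`; hence the window matrix has rank `≤ rank M_π`.
[folklore] -/
theorem rank_windowMatrix_le {α β : Type} [Fintype α] [Fintype β]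
    (n K : ℕ) (π : Fin n ⊕ Fin n ≃ Fin (2 * n)) (s : ℕ) (hs : s + K ≤ 2 * n) (w : ℕ → Bool)
    (hw : ∀ j : Fin (2 * n), s ≤ (j : ℕ) → (j : ℕ) < s + K → w ((j : ℕ) - s) = (π.symm j).isLeft)
    (xr : α → ℕ → Bool) (yc : β → ℕ → Bool) :
    (Matrix.of fun a b =>
        (((liouville (Nat.ofBits (fun k : Fin K => if w k then xr a k else yc b k) + 1) : ℤ) : ℂ))).rank ≤
      (Matrix.of fun r c : Fin n → Bool =>
        (((liouville (Nat.ofBits (fun j : Fin (2 * n) => Sum.elim r c (π.symm j)) + 1) : ℤ) :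
          ℂ))).rank := by
  classical
  set M₁ : Matrix α β ℂ := Matrix.of fun a b =>
      (((liouville (Nat.ofBits (fun k : Fin K => if w k then xr a k else yc b k) + 1) : ℤ) : ℂ))
    with hM₁
  set M : Matrix (Fin n → Bool) (Fin n → Bool) ℂ := Matrix.of fun r c : Fin n → Bool =>
      (((liouville (Nat.ofBits (fun j : Fin (2 * n) => Sum.elim r c (π.symm j)) + 1) : ℤ) : ℂ))
    with hM
  -- extension of a local window stream to all positions: ones below the window, zeros above it
  let ext : (ℕ → Bool) → ℕ → Bool := fun z j =>
    if j < s then true else if j < s + K then z (j - s) else false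
  -- the merged local stream
  let z : α → β → ℕ → Bool := fun a b k => if w k then xr a k else yc b k
  -- the row / column embeddings
  let ρ : α → (Fin n → Bool) := fun a i => ext (xr a) (π (Sum.inl i))
  let γ : β → (Fin n → Bool) := fun b i => ext (yc b) (π (Sum.inr i))
  -- (1) the global bit vector at `(ρ a, γ b)` is the extension of the merged local stream
  have hglob : ∀ a b (j : Fin (2 * n)), Sum.elim (ρ a) (γ b) (π.symm j) = ext (z a b) j := by
    intro a b j
    rcases hj : π.symm j with i | i
    · have hji : π (Sum.inl i) = j := by rw [← hj, Equiv.apply_symm_apply]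
      rw [Sum.elim_inl]
      show ext (xr a) (π (Sum.inl i)) = ext (z a b) j
      rw [hji]
      by_cases h1 : (j : ℕ) < s
      · simp [ext, h1]
      · by_cases h2 : (j : ℕ) < s + K
        · have hl : w ((j : ℕ) - s) = true := by rw [hw j (not_lt.mp h1) h2, hj, Sum.isLeft_inl]
          simp [ext, h1, h2, z, hl]
        · simp [ext, h1, h2]
    · have hji : π (Sum.inr i) = j := by rw [← hj, Equiv.apply_symm_apply]
      rw [Sum.elim_inr]
      show ext (yc b) (π (Sum.inr i)) = ext (z a b) j
      rw [hji]
      by_cases h1 : (j : ℕ) < s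
      · simp [ext, h1]
      · by_cases h2 : (j : ℕ) < s + K
        · have hl : w ((j : ℕ) - s) = false := by rw [hw j (not_lt.mp h1) h2, hj, Sum.isLeft_inr]
          simp [ext, h1, h2, z, hl]
        · simp [ext, h1, h2]
  -- (2) the number with extended bits: `N + 1 = 2^s (N₁ + 1)`
  have hext : ∀ zz : ℕ → Bool,
      Nat.ofBits (fun j : Fin (2 * n) => ext zz j) + 1 =
        2 ^ s * (Nat.ofBits (fun k : Fin K => zz k) + 1) := by
    intro zz
    have h1 : Nat.ofBits (fun j : Fin (2 * n) => ext zz j) =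
        2 ^ s * Nat.ofBits (fun k : Fin K => zz k) + (2 ^ s - 1) := by
      apply Nat.eq_of_testBit_eq
      intro i
      rw [Nat.testBit_ofBits,
        Nat.testBit_two_pow_mul_add _ (Nat.sub_lt (Nat.two_pow_pos s) Nat.one_pos),
        Nat.testBit_two_pow_sub_one, Nat.testBit_ofBits]
      simp only [ext]
      split_ifs <;> simp_all <;> omega
    rw [h1, Nat.mul_add, mul_one, Nat.add_assoc, Nat.sub_add_cancel Nat.one_le_two_pow]
  -- (3) entries of the submatrix
  have hentry : ∀ a b, M (ρ a) (γ b) = (-1 : ℂ) ^ s * M₁ a b := by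
    intro a b
    have hfun : (fun j : Fin (2 * n) => Sum.elim (ρ a) (γ b) (π.symm j)) =
        fun j : Fin (2 * n) => ext (z a b) j := funext (hglob a b)
    have hN : Nat.ofBits (fun j : Fin (2 * n) => Sum.elim (ρ a) (γ b) (π.symm j)) + 1 =
        2 ^ s * (Nat.ofBits (fun k : Fin K => z a b k) + 1) := by
      rw [hfun, hext (z a b)]
    simp only [hM, hM₁, Matrix.of_apply]
    rw [hN, liouville_two_pow_mul]
    push_cast
    ring
  -- (4) the submatrix is `(-1)^s • M₁`, so `M₁ = (-1)^s • submatrix`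
  have hsub : M.submatrix ρ γ = ((-1 : ℂ) ^ s) • M₁ := by
    ext a b
    simp only [Matrix.submatrix_apply, Matrix.smul_apply, smul_eq_mul]
    exact hentry a b
  have hM₁eq : M₁ = ((-1 : ℂ) ^ s) • M.submatrix ρ γ := by
    rw [hsub, smul_smul, ← mul_pow, neg_one_mul, neg_neg, one_pow, one_smul]
  calc M₁.rank = (((-1 : ℂ) ^ s) • M.submatrix ρ γ).rank := by rw [← hM₁eq]
    _ = (Matrix.diagonal (fun _ : α => (-1 : ℂ) ^ s) * M.submatrix ρ γ).rank := by
        congr 1; ext a b; simp [Matrix.diagonal_mul]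
    _ ≤ (M.submatrix ρ γ).rank := Matrix.rank_mul_le_right _ _
    _ ≤ M.rank := Matrix.rank_submatrix_le M ρ γ

/-- The entries of a window matrix `(λ(K_w(xr a, yc b) + 1))_{a,b}` are `±1`. [folklore] -/
theorem windowMatrix_entry_eq_or {α β : Type} (K : ℕ) (w : ℕ → Bool) (xr : α → ℕ → Bool) (yc : β → ℕ → Bool)
    (a : α) (b : β) :
    (Matrix.of fun a b =>
        (((liouville (Nat.ofBits (fun k : Fin K => if w k then xr a k else yc b k) + 1) : ℤ) : ℂ))) a b = 1 ∨
      (Matrix.of fun a b =>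
        (((liouville (Nat.ofBits (fun k : Fin K => if w k then xr a k else yc b k) + 1) : ℤ) : ℂ))) a b = -1 := by
  rw [Matrix.of_apply, liouville_apply (Nat.succ_ne_zero _)]
  rcases neg_one_pow_eq_or ℤ
      (cardFactors (Nat.ofBits (fun k : Fin K => if w k then xr a k else yc b k) + 1)) with h | h
  · left; rw [h]; norm_num
  · right; rw [h]; norm_num

/-! ### §2 Distinct window columns bound the rank -/

/-- **Distinct columns of a `±1` matrix are few**: at most `2 ^ rank` (the row version
`card_image_row_le_two_pow_rank` applied to the transpose). [folklore] -/
theorem card_image_col_le_two_pow_rank {m' n' : Type} [Fintype m'] [Fintype n'] [DecidableEq m']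
    (A : Matrix m' n' ℂ) (hA : ∀ i j, A i j = 1 ∨ A i j = -1) :
    (Finset.univ.image fun j : n' => fun i : m' => A i j).card ≤ 2 ^ A.rank := by
  classical
  have h := card_image_row_le_two_pow_rank A.transpose (fun j i => hA i j)
  rw [Matrix.rank_transpose] at h
  exact h

/-- ★ **Distinct window columns bound the rank of the cut matrix.**  For ANY window of a cut `π` (no balance, no
`λ`-table) and any row/column stream families: if the window matrix `(λ(K_w(xr a, yc b) + 1))_{a,b}` has at least
`2^m` pairwise distinct columns `a ↦ λ(K_w(xr a, yc b) + 1)`, then `m ≤ rank M_π`.  (For the window `(R^L C)^k`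
of Class B with all row streams: `2^k` pairwise distinct aligned-blocks-with-digits give `rank ≥ k`.) [folklore] -/
theorem le_rank_of_distinct_windowColumns {α β : Type} [Fintype α] [Fintype β] [DecidableEq α]
    (n K : ℕ) (π : Fin n ⊕ Fin n ≃ Fin (2 * n)) (s : ℕ) (hs : s + K ≤ 2 * n) (w : ℕ → Bool)
    (hw : ∀ j : Fin (2 * n), s ≤ (j : ℕ) → (j : ℕ) < s + K → w ((j : ℕ) - s) = (π.symm j).isLeft)
    (xr : α → ℕ → Bool) (yc : β → ℕ → Bool) (m : ℕ)
    (hdist : 2 ^ m ≤ (Finset.univ.image fun b : β => fun a : α =>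
        (((liouville (Nat.ofBits (fun k : Fin K => if w k then xr a k else yc b k) + 1) : ℤ) : ℂ))).card) :
    m ≤ (Matrix.of fun r c : Fin n → Bool =>
        (((liouville (Nat.ofBits (fun j : Fin (2 * n) => Sum.elim r c (π.symm j)) + 1) : ℤ) :
          ℂ))).rank := by
  classical
  set M₁ : Matrix α β ℂ := Matrix.of fun a b =>
      (((liouville (Nat.ofBits (fun k : Fin K => if w k then xr a k else yc b k) + 1) : ℤ) : ℂ))
    with hM₁
  have hcols : (Finset.univ.image fun b : β => fun a : α => M₁ a b).card ≤ 2 ^ M₁.rank :=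
    card_image_col_le_two_pow_rank M₁ (fun a b => windowMatrix_entry_eq_or K w xr yc a b)
  have h1 : 2 ^ m ≤ 2 ^ M₁.rank := le_trans hdist (by simpa [hM₁] using hcols)
  have h2 : m ≤ M₁.rank := (Nat.pow_le_pow_iff_right Nat.one_lt_two).mp h1
  exact h2.trans (rank_windowMatrix_le n K π s hs w hw xr yc)

end Summit.ValiantsHypothesis.ValiantsHypothesis.Theorems.LiouvilleSarnakLiouvilleCutRank.WindowColumns
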